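import Summits.SmoothPoincare4.SmoothPoincare4.Theorems.ConvexBisectionSteinBisectionExistsOfKahlerDecomposition
import Summits.SmoothPoincare4.SmoothPoincare4.Theorems.ConvexBisectionAcyclicBisectionExistsStubGirouxGray
import Literature.Geometry.Symplectic.GirouxContactPathProofs
import Literature.Topology.FourManifolds.GluingIsotopyProofs
import Literature.Topology.FourManifolds.ClosedBallProofs
import Mathlib.Geometry.Manifold.LocalDiffeomorph

/-!
# `ConvexBisection.SteinBisectionExists` (item stmt-SmoothPoincare4-10509): the VERBATIM forms of
# Baykur's theorem suffice — "isotopic contact structures" and "a common supporting open book"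

The support item `Summit.SmoothPoincare4.SmoothPoincare4.Theses.ConvexBisection.SteinBisectionExists`
is closed CONDITIONALLY on the named fact `Literature.Geometry.Symplectic.baykur_kahlerDecomposition`
(`steinBisectionExists_of_baykur`, `Theorems/ConvexBisectionSteinBisectionExistsOfKahlerDecomposition.lean`),
which renders R. İ. Baykur, *Kähler decomposition of 4-manifolds*, Algebr. Geom. Topol. 6 (2006),
Thm. 5.1 with its clause *"the induced contact structures `ξ₊` on `∂X₊` and `ξ₋` on `−∂X₋` are
isotopic"* already post-processed into POINTWISE equality of the two plane fields under the
gluing map (deviation 1 of that fact's docstring: Gray stability + a collar twist).  This file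
proves that the post-processing is free — the more literal renderings of the printed theorem imply
(the first two are equivalent to) the pointwise one — using only PROVED results of the tree, so
that the residual debt of the item is exactly the geometric core of Baykur's proof (Lemma 5.1:
matching allowable achiral Lefschetz fibrations on the two handlebodies; PALF ⇒ Stein with the
boundary open book supporting the induced contact structure), with no contact-topological
post-processing left in it.

For ONE closed 4-manifold `X = W₁ ∪_φ W₂` (`IsBoundaryGluing b₁ b₂ φ (𝓡 4) X`) with compact Stein
pieces `(W₁, S₁)`, `(W₂, S₂)`, writing `ξ₁' = boundaryPlaneField S₁.J b₁` (the `J₁`-complex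
tangencies on the abstract boundary `∂W₁ = b₁.carrier`), `ξ₂' = boundaryPlaneField S₂.J b₂` and
`ι₂ = b₂.incl`:

* `twistedGlue_of_isotopicGluingMap`, `isSmoothlyIsotopic_self` — **"the gluing diffeomorphism
  `φ` is isotopic to a contactomorphism `ψ`"** (`IsSmoothlyIsotopic ψ φ` and
  `d(ι₂ ∘ ψ) ξ₁' = contactPlane S₂.J` pointwise) gives the fact's clause for `ψ` — `X` is also
  `W₁ ∪_ψ W₂` by the PROVED isotopy invariance of gluing
  `Literature.Topology.FourManifolds.IsBoundaryGluing.of_isSmoothlyIsotopic` (Hirsch 1976, Ch. 8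
  §2, Thm. 2.3: collar + isotopy extension); conversely the fact's clause is the case `ψ = φ`.
  Since `ψ ≃ φ` iff `ψ ∘ φ⁻¹ ∈ Diff₀(∂W₂)`, and `ψ` is a contactomorphism iff `ψ ∘ φ⁻¹` carries
  `φ_* ξ₁` onto `ξ₂`, this is print's "the induced contact structures on `H = ∂X₊ = −∂X₋` are
  isotopic", read on `∂W₂`.
* `isotopicGluingMap_of_isotopicForm` — the same read on `∂W₁`, in the form produced by Gray's
  theorem and used by the crux line `Cruxes/AcyclicBisectionExists/Lines/modp-braid-orbits.lean`:
  a self-diffeomorphism `φ₀` of `∂W₁` isotopic to the identity with `dφ₀(ξ₁') = φ^* ξ₂'` gives the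
  contactomorphism `ψ = φ₀ ≫ φ` isotopic to `φ` (post-composition of the isotopy; chain rule).
* `exists_isotopicForm_of_commonOpenBook` — if ONE open book of `∂W₁` carries Giroux forms for
  both `ξ₁'` and `φ^* ξ₂'` inducing the same orientation (print's last clause: *"there are PALFs
  on each piece such that the open book decompositions they induce on `∂X₊` and `−∂X₋` are
  compatible with `ξ₊` and `ξ₋`, respectively, and they coincide"*), such a `φ₀` exists —
  Giroux's uniqueness (named fact `Literature.Geometry.Symplectic.GirouxContactPath`, hypothesis)
  and Gray's stability theorem (`Literature.Geometry.Symplectic.GrayStability_holds`, PROVED),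
  through the landed `stub_girouxGray_of`.
* `steinBisectionExists_iff_isotopicGluingMap`, `baykur_kahlerDecomposition_iff_isotopicGluingMap`
  — hence THE ITEM IS EQUIVALENT TO the Stein + isotopy clauses of Baykur's Thm. 5.1 restricted to
  homotopy 4-spheres, and the named fact to the same clauses for all closed connected orientable
  4-manifolds; `steinBisectionExists_of_kahlerDecomposition_isotopic`,
  `steinBisectionExists_of_kahlerDecomposition_openBook` — the item from either verbatim
  rendering (the open-book one modulo `GirouxContactPath`).

No new definitions, no new named facts.
-/

noncomputable section

-- the prescribed namespace `Summit.<P>.<Sub>.…` duplicates `SmoothPoincare4` (P = Sub)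
set_option linter.dupNamespace false

open scoped Manifold ContDiff Topology ContinuousMap
open Set Function
open Literature.Geometry.Symplectic Literature.Topology.FourManifolds

namespace Summit.SmoothPoincare4.SmoothPoincare4.Theorems.SteinBisection

open Summit.SmoothPoincare4.SmoothPoincare4.Theses.ConvexBisection
open Summit.SmoothPoincare4.SmoothPoincare4.Theorems.AcyclicBisectionExists.Negative
  (map_mfderiv_incl_boundaryPlaneField)
open Summit.SmoothPoincare4.SmoothPoincare4.Theorems.AcyclicBisectionExists.ModpBraidOrbits
  (stub_girouxGray_of)

/-- **A diffeomorphism is smoothly isotopic to itself** (constant isotopy; a diffeomorphism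
`X ≅ Y` is a smooth embedding as `φ ∘ id`, Mathlib `Manifold.IsSmoothEmbedding.id` and the tree's
`Manifold.IsSmoothEmbedding.diffeomorph_comp`). Hirsch, *Differential Topology* (1976), §8.1.
[folklore] -/
theorem isSmoothlyIsotopic_self {EM HM : Type*} [NormedAddCommGroup EM] [NormedSpace ℝ EM]
    [TopologicalSpace HM] {I : ModelWithCorners ℝ EM HM} {X Y : Type*} [TopologicalSpace X]
    [ChartedSpace HM X] [IsManifold I ∞ X] [TopologicalSpace Y] [ChartedSpace HM Y]
    [IsManifold I ∞ Y] (φ : X ≃ₘ⟮I, I⟯ Y) : IsSmoothlyIsotopic I I ⇑φ ⇑φ :=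
  ⟨SmoothIsotopy.refl ((Manifold.IsSmoothEmbedding.id (I := I) (M := X) (n := ∞)).diffeomorph_comp φ)⟩

section OneManifold

variable {X : Type} [TopologicalSpace X] [T2Space X] [SecondCountableTopology X]
  [ChartedSpace (EuclideanSpace ℝ (Fin 4)) X] [IsManifold (𝓡 4) ∞ X]
  {W₁ : Type} [TopologicalSpace W₁] [ChartedSpace (EuclideanHalfSpace 4) W₁]
  [IsManifold (𝓡∂ 4) ∞ W₁] [CompactSpace W₁]
  {W₂ : Type} [TopologicalSpace W₂] [ChartedSpace (EuclideanHalfSpace 4) W₂]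
  [IsManifold (𝓡∂ 4) ∞ W₂] [CompactSpace W₂]

omit [SecondCountableTopology X] [IsManifold (𝓡 4) ∞ X] in
/-- **Gluing map isotopic to a contactomorphism ⇒ the fact's pointwise clause.**  If
`X = W₁ ∪_φ W₂` and `ψ : ∂W₁ ≅ ∂W₂` is smoothly isotopic to `φ` and carries `ξ₁'` onto
`contactPlane S₂.J` pointwise, then `X = W₁ ∪_ψ W₂` as well — the PROVED isotopy invariance of
gluing `IsBoundaryGluing.of_isSmoothlyIsotopic` (Hirsch 1976, Ch. 8 §2, Thm. 2.3; `W₂` is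
Hausdorff as a subspace of `X` through the gluing) — so `ψ` witnesses the contact-matching clause
of `baykur_kahlerDecomposition` for `X`. [cite: Baykur2006, Thm. 5.1] -/
theorem twistedGlue_of_isotopicGluingMap (S₁ : SteinStructure W₁) (S₂ : SteinStructure W₂)
    (b₁ : BoundaryData (𝓡∂ 4) W₁ (𝓡 3)) (b₂ : BoundaryData (𝓡∂ 4) W₂ (𝓡 3))
    {φ ψ : b₁.carrier ≃ₘ⟮𝓡 3, 𝓡 3⟯ b₂.carrier} (hglue : IsBoundaryGluing b₁ b₂ φ (𝓡 4) X)
    (hiso : IsSmoothlyIsotopic (𝓡 3) (𝓡 3) ⇑ψ ⇑φ)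
    (hψ : ∀ z, Submodule.map (mfderiv (𝓡 3) (𝓡∂ 4) (b₂.incl ∘ ψ) z).toLinearMap
        (boundaryPlaneField S₁.J b₁ z) = contactPlane S₂.J (b₂.incl (ψ z))) :
    (∀ z, Submodule.map (mfderiv (𝓡 3) (𝓡∂ 4) (b₂.incl ∘ ψ) z).toLinearMap
        (boundaryPlaneField S₁.J b₁ z) = contactPlane S₂.J (b₂.incl (ψ z))) ∧
      IsBoundaryGluing b₁ b₂ ψ (𝓡 4) X := by
  -- `W₂` is Hausdorff: it embeds into the Hausdorff `X` through the gluing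
  haveI : T2Space W₂ := by
    obtain ⟨_, jB, -, hB, -, -⟩ := hglue.isClosedGluing
    exact hB.isEmbedding.t2Space
  exact ⟨hψ, hglue.of_isSmoothlyIsotopic hiso⟩

/-- **The `∂W₁`-reading: a self-diffeomorphism `φ₀` of `∂W₁` isotopic to the identity with
`dφ₀(ξ₁') = φ^* ξ₂'` gives the contactomorphism `ψ = φ₀ ≫ φ` isotopic to `φ`.**  Isotopy:
post-compose a smooth isotopy `φ₀ ≃ id` with `φ` (stages `φ ∘ F_t` are smooth embeddings by
`Manifold.IsSmoothEmbedding.diffeomorph_comp`).  Planes: `d(ι₂ ∘ φ ∘ φ₀) ξ₁' =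
dι₂ (dφ (dφ₀ ξ₁')) = dι₂ (dφ (dφ⁻¹ ξ₂')) = dι₂ ξ₂' = contactPlane S₂.J` — chain rule
(`mfderiv_comp`), `dφ` onto (`Diffeomorph.mfderivToContinuousLinearEquiv`), and
`map_mfderiv_incl_boundaryPlaneField` (`Negative/TwistedDoubles.lean`).  (Same computation as
the crux line's `stub_contactoPlanes`; restated here to keep this file's import cone built.)
[folklore] -/
theorem isotopicGluingMap_of_isotopicForm (S₁ : SteinStructure W₁) (S₂ : SteinStructure W₂)
    (b₁ : BoundaryData (𝓡∂ 4) W₁ (𝓡 3)) (b₂ : BoundaryData (𝓡∂ 4) W₂ (𝓡 3))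
    (φ : b₁.carrier ≃ₘ⟮𝓡 3, 𝓡 3⟯ b₂.carrier) (φ₀ : b₁.carrier ≃ₘ⟮𝓡 3, 𝓡 3⟯ b₁.carrier)
    (hiso : Literature.Topology.FourManifolds.Diffeomorph.IsIsotopic φ₀
      (Diffeomorph.refl (𝓡 3) b₁.carrier ∞))
    (hplanes : ∀ y, (boundaryPlaneField S₁.J b₁ y).map (mfderiv (𝓡 3) (𝓡 3) φ₀ y).toLinearMap =
        (boundaryPlaneField S₂.J b₂ (φ (φ₀ y))).comap
          (mfderiv (𝓡 3) (𝓡 3) φ (φ₀ y)).toLinearMap) :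
    IsSmoothlyIsotopic (𝓡 3) (𝓡 3) ⇑(φ₀.trans φ) ⇑φ ∧
      ∀ z, Submodule.map (mfderiv (𝓡 3) (𝓡∂ 4) (b₂.incl ∘ ⇑(φ₀.trans φ)) z).toLinearMap
          (boundaryPlaneField S₁.J b₁ z) = contactPlane S₂.J (b₂.incl ((φ₀.trans φ) z)) := by
  constructor
  · -- post-compose the isotopy `φ₀ ≃ id` with `φ`
    obtain ⟨F⟩ := hiso
    refine ⟨{ toFun := fun t => φ ∘ F.toFun t
              contMDiff := φ.contMDiff.comp F.contMDiff
              isSmoothEmbedding := fun t => (F.isSmoothEmbedding t).diffeomorph_comp φ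
              map_zero := by rw [F.map_zero, Diffeomorph.coe_trans]
              map_one := by rw [F.map_one, Diffeomorph.coe_refl, Function.comp_id] }⟩
  · intro z
    -- smoothness of the three factors
    have hφ₀d : MDifferentiableAt (𝓡 3) (𝓡 3) φ₀ z := φ₀.mdifferentiable (by simp) _
    have hφd : MDifferentiableAt (𝓡 3) (𝓡 3) φ (φ₀ z) := φ.mdifferentiable (by simp) _
    have hι₂ : MDifferentiableAt (𝓡 3) (𝓡∂ 4) b₂.incl (φ (φ₀ z)) :=
      b₂.isSmoothEmbedding.contMDiff.mdifferentiableAt (by simp)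
    have hι₂φ : MDifferentiableAt (𝓡 3) (𝓡∂ 4) (b₂.incl ∘ φ) (φ₀ z) := hι₂.comp (φ₀ z) hφd
    -- `ι₂ ∘ (φ₀ ≫ φ) = (ι₂ ∘ φ) ∘ φ₀`
    have e0 : (b₂.incl ∘ ⇑(φ₀.trans φ)) = (b₂.incl ∘ ⇑φ) ∘ ⇑φ₀ := rfl
    -- chain rule, twice
    have e1 : mfderiv (𝓡 3) (𝓡∂ 4) ((b₂.incl ∘ ⇑φ) ∘ ⇑φ₀) z =
        (mfderiv (𝓡 3) (𝓡∂ 4) (b₂.incl ∘ ⇑φ) (φ₀ z)).comp (mfderiv (𝓡 3) (𝓡 3) φ₀ z) :=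
      mfderiv_comp z hι₂φ hφ₀d
    have e2 : mfderiv (𝓡 3) (𝓡∂ 4) (b₂.incl ∘ ⇑φ) (φ₀ z) =
        (mfderiv (𝓡 3) (𝓡∂ 4) b₂.incl (φ (φ₀ z))).comp (mfderiv (𝓡 3) (𝓡 3) φ (φ₀ z)) :=
      mfderiv_comp (φ₀ z) hι₂ hφd
    -- `dφ` is onto
    have hsurj : Surjective (mfderiv (𝓡 3) (𝓡 3) φ (φ₀ z)).toLinearMap := by
      have := (φ.mfderivToContinuousLinearEquiv (by simp) (φ₀ z)).surjective
      rwa [← ContinuousLinearEquiv.coe_coe, Diffeomorph.mfderivToContinuousLinearEquiv_coe] at this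
    -- assemble
    have step1 : Submodule.map (mfderiv (𝓡 3) (𝓡∂ 4) (b₂.incl ∘ ⇑(φ₀.trans φ)) z).toLinearMap
          (boundaryPlaneField S₁.J b₁ z) =
        Submodule.map (mfderiv (𝓡 3) (𝓡∂ 4) (b₂.incl ∘ ⇑φ) (φ₀ z)).toLinearMap
          (Submodule.map (mfderiv (𝓡 3) (𝓡 3) φ₀ z).toLinearMap
            (boundaryPlaneField S₁.J b₁ z)) := by
      rw [← Submodule.map_comp, e0]
      exact congrArg (fun T : TangentSpace (𝓡 3) z →L[ℝ] TangentSpace (𝓡∂ 4) (b₂.incl (φ (φ₀ z))) =>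
        Submodule.map T.toLinearMap (boundaryPlaneField S₁.J b₁ z)) e1
    have step2 : Submodule.map (mfderiv (𝓡 3) (𝓡∂ 4) (b₂.incl ∘ ⇑φ) (φ₀ z)).toLinearMap
          (Submodule.map (mfderiv (𝓡 3) (𝓡 3) φ₀ z).toLinearMap (boundaryPlaneField S₁.J b₁ z)) =
        Submodule.map (mfderiv (𝓡 3) (𝓡∂ 4) b₂.incl (φ (φ₀ z))).toLinearMap
          (Submodule.map (mfderiv (𝓡 3) (𝓡 3) φ (φ₀ z)).toLinearMap
            (Submodule.comap (mfderiv (𝓡 3) (𝓡 3) φ (φ₀ z)).toLinearMap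
              (boundaryPlaneField S₂.J b₂ (φ (φ₀ z))))) := by
      rw [hplanes z, ← Submodule.map_comp]
      exact congrArg (fun T : TangentSpace (𝓡 3) (φ₀ z) →L[ℝ] TangentSpace (𝓡∂ 4) (b₂.incl (φ (φ₀ z))) =>
        Submodule.map T.toLinearMap
          (Submodule.comap (mfderiv (𝓡 3) (𝓡 3) φ (φ₀ z)).toLinearMap
            (boundaryPlaneField S₂.J b₂ (φ (φ₀ z))))) e2
    have step3 : Submodule.map (mfderiv (𝓡 3) (𝓡∂ 4) b₂.incl (φ (φ₀ z))).toLinearMap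
          (Submodule.map (mfderiv (𝓡 3) (𝓡 3) φ (φ₀ z)).toLinearMap
            (Submodule.comap (mfderiv (𝓡 3) (𝓡 3) φ (φ₀ z)).toLinearMap
              (boundaryPlaneField S₂.J b₂ (φ (φ₀ z))))) =
        contactPlane S₂.J (b₂.incl (φ (φ₀ z))) := by
      rw [Submodule.map_comap_eq_of_surjective hsurj, map_mfderiv_incl_boundaryPlaneField]
    exact step1.trans (step2.trans step3)

/-- **Common supporting open book ⇒ isotopic** (Giroux + Gray).  If one open book `ob` of `∂W₁`
carries Giroux forms `α`, `α'` for `ξ₁'` and for `φ^* ξ₂'` inducing the same orientation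
(`α ∧ dα` and `α' ∧ dα'` positive on the same frames), then some `φ₀` isotopic to the identity
carries `ξ₁'` onto `φ^* ξ₂'`: Giroux's path of contact forms (named fact `GirouxContactPath`,
hypothesis `hG`) integrated by Gray's stability theorem (`GrayStability_holds`, proved), i.e. the
landed `stub_girouxGray_of`.  `∂W₁` is compact (`W₁` is) and Hausdorff (`W₁` is assumed so).
[cite: Baykur2006, Thm. 5.1] -/
theorem exists_isotopicForm_of_commonOpenBook (hG : GirouxContactPath) [T2Space W₁]
    (S₁ : SteinStructure W₁) (S₂ : SteinStructure W₂)
    (b₁ : BoundaryData (𝓡∂ 4) W₁ (𝓡 3)) (b₂ : BoundaryData (𝓡∂ 4) W₂ (𝓡 3))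
    (φ : b₁.carrier ≃ₘ⟮𝓡 3, 𝓡 3⟯ b₂.carrier) (ob : OpenBook b₁.carrier)
    (α α' : Literature.Geometry.Kaehler.MForm (𝓡 3) b₁.carrier ℝ 1)
    (hα : ob.IsGirouxForm (boundaryPlaneField S₁.J b₁) α)
    (hα' : ob.IsGirouxForm (fun y => (boundaryPlaneField S₂.J b₂ (φ y)).comap
      (mfderiv (𝓡 3) (𝓡 3) φ y).toLinearMap) α')
    (hor : ∀ y u v w, 0 < wedge₁₂ (α y) (Literature.Geometry.Kaehler.mextDeriv α y) u v w ↔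
      0 < wedge₁₂ (α' y) (Literature.Geometry.Kaehler.mextDeriv α' y) u v w) :
    ∃ φ₀ : b₁.carrier ≃ₘ⟮𝓡 3, 𝓡 3⟯ b₁.carrier,
      Literature.Topology.FourManifolds.Diffeomorph.IsIsotopic φ₀
          (Diffeomorph.refl (𝓡 3) b₁.carrier ∞) ∧
        ∀ y, (boundaryPlaneField S₁.J b₁ y).map (mfderiv (𝓡 3) (𝓡 3) φ₀ y).toLinearMap =
          (boundaryPlaneField S₂.J b₂ (φ (φ₀ y))).comap
            (mfderiv (𝓡 3) (𝓡 3) φ (φ₀ y)).toLinearMap := by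
  haveI : T2Space b₁.carrier := b₁.isSmoothEmbedding.isEmbedding.t2Space
  haveI : CompactSpace b₁.carrier := b₁.compactSpace_carrier
  exact stub_girouxGray_of hG GrayStability_holds b₁.carrier ob _ _ α α' hα hα' hor

end OneManifold

/-! ## The item and the fact are their verbatim-isotopic renderings -/

/-- **The item ⇔ Baykur's Stein + isotopy clauses at homotopy 4-spheres**: `SteinBisectionExists`
holds iff every smooth `M ≃ₕ S⁴` (Hausdorff, second countable) is a gluing `W₁ ∪_φ W₂`
(`IsBoundaryGluing`) of two compact Stein domains whose gluing diffeomorphism `φ` is smoothly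
isotopic to a contactomorphism `ψ` of the induced boundary plane fields
(`d(ι₂ ∘ ψ) ξ₁' = contactPlane S₂.J`), i.e. whose two induced seam contact structures are
isotopic.  (`→`: `steinBisectionExists_iff_twistedDouble` and `ψ = φ`; `←`:
`twistedGlue_of_isotopicGluingMap`.) [cite: Baykur2006, Thm. 5.1] -/
theorem steinBisectionExists_iff_isotopicGluingMap :
    SteinBisectionExists ↔
      ∀ (M : Type) [TopologicalSpace M] [T2Space M] [SecondCountableTopology M]
        [ChartedSpace (EuclideanSpace ℝ (Fin 4)) M] [IsManifold (𝓡 4) ∞ M],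
        M ≃ₕ (Metric.sphere (0 : EuclideanSpace ℝ (Fin 5)) 1) →
        ∃ (W₁ : Type) (_ : TopologicalSpace W₁) (_ : ChartedSpace (EuclideanHalfSpace 4) W₁)
          (_ : IsManifold (𝓡∂ 4) ∞ W₁) (_ : CompactSpace W₁)
          (W₂ : Type) (_ : TopologicalSpace W₂) (_ : ChartedSpace (EuclideanHalfSpace 4) W₂)
          (_ : IsManifold (𝓡∂ 4) ∞ W₂) (_ : CompactSpace W₂)
          (S₁ : SteinStructure W₁) (S₂ : SteinStructure W₂)
          (b₁ : BoundaryData (𝓡∂ 4) W₁ (𝓡 3)) (b₂ : BoundaryData (𝓡∂ 4) W₂ (𝓡 3))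
          (φ ψ : b₁.carrier ≃ₘ⟮𝓡 3, 𝓡 3⟯ b₂.carrier),
          IsBoundaryGluing b₁ b₂ φ (𝓡 4) M ∧ IsSmoothlyIsotopic (𝓡 3) (𝓡 3) ⇑ψ ⇑φ ∧
          ∀ z, Submodule.map (mfderiv (𝓡 3) (𝓡∂ 4) (b₂.incl ∘ ψ) z).toLinearMap
              (boundaryPlaneField S₁.J b₁ z) = contactPlane S₂.J (b₂.incl (ψ z)) := by
  rw [steinBisectionExists_iff_twistedDouble]
  constructor
  · intro h M _ _ _ _ _ e
    obtain ⟨W₁, t₁, c₁, m₁, k₁, W₂, t₂, c₂, m₂, k₂, S₁, S₂, b₁, b₂, ψ, hψ, hglue⟩ := h M e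
    exact ⟨W₁, t₁, c₁, m₁, k₁, W₂, t₂, c₂, m₂, k₂, S₁, S₂, b₁, b₂, ψ, ψ, hglue,
      isSmoothlyIsotopic_self ψ, hψ⟩
  · intro h M _ _ _ _ _ e
    obtain ⟨W₁, t₁, c₁, m₁, k₁, W₂, t₂, c₂, m₂, k₂, S₁, S₂, b₁, b₂, φ, ψ, hglue, hiso, hψ⟩ := h M e
    obtain ⟨-, hglue'⟩ := twistedGlue_of_isotopicGluingMap S₁ S₂ b₁ b₂ hglue hiso hψ
    exact ⟨W₁, t₁, c₁, m₁, k₁, W₂, t₂, c₂, m₂, k₂, S₁, S₂, b₁, b₂, ψ, hψ, hglue'⟩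

/-- **`baykur_kahlerDecomposition` ⇔ its verbatim-isotopic rendering**: every closed connected
orientable smooth 4-manifold is `W₁ ∪_φ W₂` with `(Wᵢ, Sᵢ)` compact Stein domains and `φ`
smoothly isotopic to a contactomorphism `ψ` of the induced boundary plane fields — print: *"`X₊`
and `−X₋` are both compact Stein manifolds with strictly pseudoconvex boundaries … the induced
contact structures `ξ₊` on `∂X₊` and `ξ₋` on `−∂X₋` are isotopic"*.  So deviation 1 of the fact's
docstring (pointwise instead of isotopic) costs nothing. [cite: Baykur2006, Thm. 5.1] -/
theorem baykur_kahlerDecomposition_iff_isotopicGluingMap :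
    baykur_kahlerDecomposition ↔
      ∀ (X : Type) [TopologicalSpace X] [T2Space X] [SecondCountableTopology X] [CompactSpace X]
        [ConnectedSpace X] [ChartedSpace (EuclideanSpace ℝ (Fin 4)) X] [IsManifold (𝓡 4) ∞ X],
        IsOrientable (𝓡 4) X →
        ∃ (W₁ : Type) (_ : TopologicalSpace W₁) (_ : ChartedSpace (EuclideanHalfSpace 4) W₁)
          (_ : IsManifold (𝓡∂ 4) ∞ W₁) (_ : CompactSpace W₁)
          (W₂ : Type) (_ : TopologicalSpace W₂) (_ : ChartedSpace (EuclideanHalfSpace 4) W₂)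
          (_ : IsManifold (𝓡∂ 4) ∞ W₂) (_ : CompactSpace W₂)
          (S₁ : SteinStructure W₁) (S₂ : SteinStructure W₂)
          (b₁ : BoundaryData (𝓡∂ 4) W₁ (𝓡 3)) (b₂ : BoundaryData (𝓡∂ 4) W₂ (𝓡 3))
          (φ ψ : b₁.carrier ≃ₘ⟮𝓡 3, 𝓡 3⟯ b₂.carrier),
          IsBoundaryGluing b₁ b₂ φ (𝓡 4) X ∧ IsSmoothlyIsotopic (𝓡 3) (𝓡 3) ⇑ψ ⇑φ ∧
          ∀ z, Submodule.map (mfderiv (𝓡 3) (𝓡∂ 4) (b₂.incl ∘ ψ) z).toLinearMap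
              (boundaryPlaneField S₁.J b₁ z) = contactPlane S₂.J (b₂.incl (ψ z)) := by
  constructor
  · intro h X _ _ _ _ _ _ _ hO
    obtain ⟨W₁, t₁, c₁, m₁, k₁, W₂, t₂, c₂, m₂, k₂, S₁, S₂, b₁, b₂, ψ, hψ, hglue⟩ := h X hO
    exact ⟨W₁, t₁, c₁, m₁, k₁, W₂, t₂, c₂, m₂, k₂, S₁, S₂, b₁, b₂, ψ, ψ, hglue,
      isSmoothlyIsotopic_self ψ, hψ⟩
  · intro h X _ _ _ _ _ _ _ hO
    obtain ⟨W₁, t₁, c₁, m₁, k₁, W₂, t₂, c₂, m₂, k₂, S₁, S₂, b₁, b₂, φ, ψ, hglue, hiso, hψ⟩ := h X hO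
    obtain ⟨-, hglue'⟩ := twistedGlue_of_isotopicGluingMap S₁ S₂ b₁ b₂ hglue hiso hψ
    exact ⟨W₁, t₁, c₁, m₁, k₁, W₂, t₂, c₂, m₂, k₂, S₁, S₂, b₁, b₂, ψ, hψ, hglue'⟩

/-! ## The item from the two verbatim renderings of Baykur's Thm. 5.1 -/

/-- **`SteinBisectionExists` from the `∂W₁`-reading of Baykur's isotopy clause** (hypothesis
`hK`: for every closed connected orientable smooth 4-manifold, a gluing into two compact Stein
domains and a self-diffeomorphism `φ₀` of `∂W₁` ISOTOPIC TO THE IDENTITY with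
`dφ₀(ξ₁') = φ^* ξ₂'`): by `isotopicGluingMap_of_isotopicForm` and
`steinBisectionExists_iff_isotopicGluingMap`, a smooth `M ≃ₕ S⁴` being compact
(`compactSpace_of_homotopyEquiv_sphere_four_holds`), path connected
(`pathConnectedSpace_of_homotopyEquiv`) and orientable
(`isOrientable_of_homotopyEquiv_sphere_four_holds`) — proved tree facts — so that `hK` applies.
[cite: Baykur2006, Thm. 5.1] -/
theorem steinBisectionExists_of_kahlerDecomposition_isotopic
    (hK : ∀ (X : Type) [TopologicalSpace X] [T2Space X] [SecondCountableTopology X] [CompactSpace X]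
        [ConnectedSpace X] [ChartedSpace (EuclideanSpace ℝ (Fin 4)) X] [IsManifold (𝓡 4) ∞ X],
        IsOrientable (𝓡 4) X →
        ∃ (W₁ : Type) (_ : TopologicalSpace W₁) (_ : ChartedSpace (EuclideanHalfSpace 4) W₁)
          (_ : IsManifold (𝓡∂ 4) ∞ W₁) (_ : CompactSpace W₁)
          (W₂ : Type) (_ : TopologicalSpace W₂) (_ : ChartedSpace (EuclideanHalfSpace 4) W₂)
          (_ : IsManifold (𝓡∂ 4) ∞ W₂) (_ : CompactSpace W₂)
          (S₁ : SteinStructure W₁) (S₂ : SteinStructure W₂)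
          (b₁ : BoundaryData (𝓡∂ 4) W₁ (𝓡 3)) (b₂ : BoundaryData (𝓡∂ 4) W₂ (𝓡 3))
          (φ : b₁.carrier ≃ₘ⟮𝓡 3, 𝓡 3⟯ b₂.carrier) (φ₀ : b₁.carrier ≃ₘ⟮𝓡 3, 𝓡 3⟯ b₁.carrier),
          IsBoundaryGluing b₁ b₂ φ (𝓡 4) X ∧
          Literature.Topology.FourManifolds.Diffeomorph.IsIsotopic φ₀
            (Diffeomorph.refl (𝓡 3) b₁.carrier ∞) ∧
          ∀ y, (boundaryPlaneField S₁.J b₁ y).map (mfderiv (𝓡 3) (𝓡 3) φ₀ y).toLinearMap =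
            (boundaryPlaneField S₂.J b₂ (φ (φ₀ y))).comap
              (mfderiv (𝓡 3) (𝓡 3) φ (φ₀ y)).toLinearMap) :
    SteinBisectionExists := by
  rw [steinBisectionExists_iff_isotopicGluingMap]
  intro M _ _ _ _ _ e
  haveI : CompactSpace M := compactSpace_of_homotopyEquiv_sphere_four_holds M e
  haveI : PathConnectedSpace (Metric.sphere (0 : EuclideanSpace ℝ (Fin 5)) 1) :=
    pathConnectedSpace_sphere_four
  haveI : PathConnectedSpace M := pathConnectedSpace_of_homotopyEquiv e
  obtain ⟨W₁, t₁, c₁, m₁, k₁, W₂, t₂, c₂, m₂, k₂, S₁, S₂, b₁, b₂, φ, φ₀, hglue, hiso, hplanes⟩ :=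
    hK M (isOrientable_of_homotopyEquiv_sphere_four_holds M e)
  obtain ⟨hiso', hψ⟩ := isotopicGluingMap_of_isotopicForm S₁ S₂ b₁ b₂ φ φ₀ hiso hplanes
  exact ⟨W₁, t₁, c₁, m₁, k₁, W₂, t₂, c₂, m₂, k₂, S₁, S₂, b₁, b₂, φ, φ₀.trans φ, hglue, hiso', hψ⟩

/-- **`SteinBisectionExists` from the open-book rendering of Baykur's Thm. 5.1** (hypothesis
`hK`: gluing into two compact Stein domains whose induced seam contact structures `ξ₁'`,
`φ^* ξ₂'` are supported, with the same orientation, by ONE open book of `∂W₁` — print's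
"compatible … and they coincide"), modulo Giroux's uniqueness `GirouxContactPath` (hypothesis
`hG`; Gray's theorem is proved in the tree): the common open book makes the two contact
structures isotopic (`exists_isotopicForm_of_commonOpenBook`; `W₁` is Hausdorff as a subspace of
`X` through the gluing), and `steinBisectionExists_of_kahlerDecomposition_isotopic` applies.
[cite: Baykur2006, Thm. 5.1] -/
theorem steinBisectionExists_of_kahlerDecomposition_openBook (hG : GirouxContactPath)
    (hK : ∀ (X : Type) [TopologicalSpace X] [T2Space X] [SecondCountableTopology X] [CompactSpace X]
        [ConnectedSpace X] [ChartedSpace (EuclideanSpace ℝ (Fin 4)) X] [IsManifold (𝓡 4) ∞ X],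
        IsOrientable (𝓡 4) X →
        ∃ (W₁ : Type) (_ : TopologicalSpace W₁) (_ : ChartedSpace (EuclideanHalfSpace 4) W₁)
          (_ : IsManifold (𝓡∂ 4) ∞ W₁) (_ : CompactSpace W₁)
          (W₂ : Type) (_ : TopologicalSpace W₂) (_ : ChartedSpace (EuclideanHalfSpace 4) W₂)
          (_ : IsManifold (𝓡∂ 4) ∞ W₂) (_ : CompactSpace W₂)
          (S₁ : SteinStructure W₁) (S₂ : SteinStructure W₂)
          (b₁ : BoundaryData (𝓡∂ 4) W₁ (𝓡 3)) (b₂ : BoundaryData (𝓡∂ 4) W₂ (𝓡 3))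
          (φ : b₁.carrier ≃ₘ⟮𝓡 3, 𝓡 3⟯ b₂.carrier)
          (ob : OpenBook b₁.carrier) (α α' : Literature.Geometry.Kaehler.MForm (𝓡 3) b₁.carrier ℝ 1),
          IsBoundaryGluing b₁ b₂ φ (𝓡 4) X ∧
          ob.IsGirouxForm (boundaryPlaneField S₁.J b₁) α ∧
          ob.IsGirouxForm (fun y => (boundaryPlaneField S₂.J b₂ (φ y)).comap
            (mfderiv (𝓡 3) (𝓡 3) φ y).toLinearMap) α' ∧
          ∀ y u v w, 0 < wedge₁₂ (α y) (Literature.Geometry.Kaehler.mextDeriv α y) u v w ↔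
            0 < wedge₁₂ (α' y) (Literature.Geometry.Kaehler.mextDeriv α' y) u v w) :
    SteinBisectionExists := by
  refine steinBisectionExists_of_kahlerDecomposition_isotopic fun X _ _ _ _ _ _ _ hO => ?_
  obtain ⟨W₁, t₁, c₁, m₁, k₁, W₂, t₂, c₂, m₂, k₂, S₁, S₂, b₁, b₂, φ, ob, α, α', hglue, hα, hα', hor⟩ :=
    hK X hO
  -- `W₁` is Hausdorff: it embeds into the Hausdorff `X` through the gluing
  haveI : T2Space W₁ := by
    obtain ⟨jA, _, hA, -, -, -⟩ := hglue.isClosedGluing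
    exact hA.isEmbedding.t2Space
  obtain ⟨φ₀, hiso, hplanes⟩ :=
    exists_isotopicForm_of_commonOpenBook hG S₁ S₂ b₁ b₂ φ ob α α' hα hα' hor
  exact ⟨W₁, t₁, c₁, m₁, k₁, W₂, t₂, c₂, m₂, k₂, S₁, S₂, b₁, b₂, φ, φ₀, hglue, hiso, hplanes⟩

end Summit.SmoothPoincare4.SmoothPoincare4.Theorems.SteinBisection

end
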